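import Literature.AnabelianGeometry.AbsoluteAnabelian.FreeProlRankCompletionProofs
import Mathlib.Topology.Algebra.Group.Quotient
import HarnessLib

/-!
# `δ¹_l` of a quotient: `δ¹_l(Γ/K) = δ¹_l(Γ)` when every continuous character of `Γ` to `ℤ_lⁿ` kills `K`

S. Mochizuki, *Topics in Absolute Anabelian Geometry I: Generalities* (2012) [AbsTopI] (lit key
`paper:url-11ac98ba15fc`), Thm 2.6 p. 21 (`δ¹_l(H) := dim_{ℚ_l} H¹(H, ℚ_l)`, typed in the tree as the free
pro-`l` rank `freeProlRank`, `ProfiniteTerminology.lean`) and Thm 2.6 (v) p. 22, where the invariant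
`ζ̃(Π) := ζ(Π/Θ)` is the invariant `ζ` of a QUOTIENT `Π/Θ` (typed `zetaTildeInv`, `AbsTopIThm26iii.lean`);
and Thm 1.7 (ii) p. 14 (elasticity of the almost pro-`p`-maximal QUOTIENTS `G_k ↠ Q`, via the ranks of
their open subgroups, p. 15 l. 1–3).  PROOF-ONLY file (no definitions, no named facts) supplying the
generic quotient plumbing for `δ¹_l`:

* `freeProlRank_quotient_le` — `δ¹_l(Γ/K) ≤ δ¹_l(Γ)` for every normal subgroup `K` (compose with the
  continuous surjection `Γ ↠ Γ/K`);
* `freeProlRank_quotient_eq_of_forall_map_eq_one` — **`δ¹_l(Γ/K) = δ¹_l(Γ)`** as soon as every continuous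
  homomorphism `Γ → ℤ_lⁿ` is trivial on `K` (then a continuous surjection `Γ ↠ ℤ_lⁿ` descends through the
  OPEN quotient map `Γ → Γ/K` to a continuous surjection `Γ/K ↠ ℤ_lⁿ`);
* `freeProlRank_quotient_eq_of_forall_hom_eq_one` — the same from the intrinsic condition on `K`: every
  continuous homomorphism `K → ℤ_lⁿ` is trivial (e.g. `K` pro-prime-to-`l`, or the kernel of a maximal
  pro-`Σ` quotient with `l ∈ Σ`).

Classical topological group theory over Mathlib; nothing here bears on [IUTchIII] Cor. 3.12.
-/

noncomputable section

open Topology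

universe u

namespace Literature.AnabelianGeometry.AbsoluteAnabelian

variable {Γ : Type u} [Group Γ] [TopologicalSpace Γ] [IsTopologicalGroup Γ]

omit [IsTopologicalGroup Γ] in
/-- `δ¹_l(Γ/K) ≤ δ¹_l(Γ)`: the quotient map is a continuous surjection.
[cite: MochizukiAbsTopI2012, Thm 2.6 p.21] -/
theorem freeProlRank_quotient_le (K : Subgroup Γ) [K.Normal] (l : ℕ) [Fact l.Prime] :
    freeProlRank (Γ ⧸ K) l ≤ freeProlRank Γ l := by
  let q : Γ →ₜ* Γ ⧸ K :=
    { toMonoidHom := QuotientGroup.mk' K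
      continuous_toFun := QuotientGroup.continuous_mk }
  exact freeProlRank_le_of_surjective q (QuotientGroup.mk'_surjective K) l

/-- **`δ¹_l(Γ/K) = δ¹_l(Γ)` when every continuous `Γ → ℤ_lⁿ` kills `K`**: a continuous surjection
`f : Γ ↠ ℤ_lⁿ` with `K ≤ Ker f` descends through the open quotient map to a continuous surjection
`Γ/K ↠ ℤ_lⁿ`. [cite: MochizukiAbsTopI2012, Thm 2.6 p.21] -/
theorem freeProlRank_quotient_eq_of_forall_map_eq_one (K : Subgroup Γ) [K.Normal] (l : ℕ) [Fact l.Prime]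
    (hK : ∀ (n : ℕ) (f : Γ →ₜ* Multiplicative (Fin n → ℤ_[l])), ∀ k ∈ K, f k = 1) :
    freeProlRank (Γ ⧸ K) l = freeProlRank Γ l := by
  refine le_antisymm (freeProlRank_quotient_le K l) ?_
  refine freeProlRank_le_of_forall l fun n f hf => ?_
  have hle : K ≤ f.toMonoidHom.ker := fun k hk => (MonoidHom.mem_ker).mpr (hK n f k hk)
  let g₀ : Γ ⧸ K →* Multiplicative (Fin n → ℤ_[l]) := QuotientGroup.lift K f.toMonoidHom hle
  have hg₀ : Continuous g₀ := by
    have hcomp : Continuous (g₀ ∘ (QuotientGroup.mk : Γ → Γ ⧸ K)) := f.continuous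
    exact (QuotientGroup.isOpenQuotientMap_mk.continuous_comp_iff).mp hcomp
  let g : Γ ⧸ K →ₜ* Multiplicative (Fin n → ℤ_[l]) := { toMonoidHom := g₀, continuous_toFun := hg₀ }
  have hgs : Function.Surjective g := by
    intro y
    obtain ⟨x, rfl⟩ := hf y
    exact ⟨QuotientGroup.mk x, rfl⟩
  exact le_freeProlRank_of_surjective l g hgs

/-- **`δ¹_l(Γ/K) = δ¹_l(Γ)` when `K` has no nontrivial continuous homomorphism to any `ℤ_lⁿ`** (the
intrinsic form: restrict a character of `Γ` to `K`). [cite: MochizukiAbsTopI2012, Thm 2.6 p.21] -/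
theorem freeProlRank_quotient_eq_of_forall_hom_eq_one (K : Subgroup Γ) [K.Normal] (l : ℕ) [Fact l.Prime]
    (hK : ∀ (n : ℕ) (φ : K →ₜ* Multiplicative (Fin n → ℤ_[l])), ∀ k, φ k = 1) :
    freeProlRank (Γ ⧸ K) l = freeProlRank Γ l := by
  refine freeProlRank_quotient_eq_of_forall_map_eq_one K l fun n f k hk => ?_
  let φ : K →ₜ* Multiplicative (Fin n → ℤ_[l]) :=
    f.comp ⟨K.subtype, continuous_subtype_val⟩
  exact hK n φ ⟨k, hk⟩

/-- The same for an open subgroup `U ⊇ K` of `Γ` in place of `Γ`: `δ¹_l(U/K) = δ¹_l(U)` (the ranks of the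
open subgroups of an almost pro-`Σ`-maximal quotient, [AbsTopI] Thm 1.7 (ii) proof p. 15), `K` viewed in
`U` as `K.subgroupOf U`. [cite: MochizukiAbsTopI2012, Thm 1.7 (ii) p.14] -/
theorem freeProlRank_quotient_subgroupOf_eq_of_forall_hom_eq_one (K U : Subgroup Γ) (hKU : K ≤ U)
    [(K.subgroupOf U).Normal] (l : ℕ) [Fact l.Prime]
    (hK : ∀ (n : ℕ) (φ : K →ₜ* Multiplicative (Fin n → ℤ_[l])), ∀ k, φ k = 1) :
    freeProlRank (U ⧸ K.subgroupOf U) l = freeProlRank U l := by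
  refine freeProlRank_quotient_eq_of_forall_hom_eq_one (K.subgroupOf U) l fun n φ x => ?_
  -- transport `φ` to a character of `K` along `K ≅ K.subgroupOf U`
  let e : K →ₜ* K.subgroupOf U :=
    { toFun := fun k => ⟨⟨k, hKU k.2⟩, Subgroup.mem_subgroupOf.mpr (by exact k.2)⟩
      map_one' := rfl
      map_mul' := fun _ _ => rfl
      continuous_toFun := (continuous_subtype_val.subtype_mk _).subtype_mk _ }
  have hx : e ⟨((x : U) : Γ), Subgroup.mem_subgroupOf.mp x.2⟩ = x := rfl
  rw [← hx]
  exact hK n (φ.comp e) _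

end Literature.AnabelianGeometry.AbsoluteAnabelian

end
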